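import Summits.Ventures.HSemireg.WedgeHankelRecurrenceCompleteIntersection

/-!
# Venture HSemireg — THE COMPLETE INTERSECTION IN EVERY DEGREE, ONE FORMULA: for `R^N(q) = r ≥ 1`, `2r ≤ N + 1`, `0 ≠ m ∈ Rec_r(q)` and a second generator `g ∈ Rec_{N+2−r}(q) ∖ m·K[X]_{≤ N+2−2r}`,
# **`Rec^N_k(q) = m·K[X]_{≤ k−r} ⊕ g·K[X]_{≤ k−(N+2−r)}` for EVERY `k ≤ N + 1`** (truncated differences: below `r` both pieces vanish, inside the window only `m` contributes — N18 —, beyond it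
# N56), the sum always direct; so `dim Rec^N_k(q) = (k + 1 − r)⁺ + (k + 1 − (N + 2 − r))⁺`

HONEST FRAMING. Part of the Lean index of the computation cell `pub-hsemireg` (seat p10 gen 29, Sunday typer «UNIFORM-IN-n»).
LINEAR ALGEBRA OF HANKEL (catalecticant) MATRICES and of polynomials over a field ONLY: no variety, no cohomology theory, no sheaf, no Ext group and no semiregularity map is constructed
here; nothing here says that HC / HC_CM / HC_AV holds; no Literature fact is declared or used.  Custodian versions as in `WedgeHankelSiegelIdeal` (1/3); the dictionary («the apolar ideal is
`(M, G)` in every degree») is QUOTED, never asserted.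

WHAT IS IN THE TREE / CHAINED.  N56 (`WedgeHankelRecurrenceCompleteIntersection`, № 380): `recSpace_beyond_eq_sup_of_not_mem`, `map_mulRight_inf_map_mulRight_eq_bot_of_not_mem`; N18 (№ 173):
`recSpace_eq_bot_of_lt`, `recSpace_eq_map_mulRight`, `finrank_map_mulRight_degreeLT`.  Mathlib: `Polynomial.mem_degreeLT`, `Submodule.map_bot`, `Submodule.finrank_sup_add_finrank_inf_eq`.
THIS FILE (namespace `Summit.Ventures.HSemireg.Wedge.HankelOuter` continued; CHAINED on N56; 0 definitions):
* §600 `degreeLT_zero_eq_bot`, `map_mulRight_degreeLT_zero` (the empty pieces), **`recSpace_eq_sup_all_degrees`** (the one formula, `k ≤ N + 1`), **`map_mulRight_inf_map_mulRight_eq_bot_all_degrees`**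
  (direct for every `k ≤ N + 1`), **`finrank_recSpace_all_degrees`** (`dim Rec_k = (k + 1 − r) + (k + 1 − (N + 2 − r))`, truncated).
Nothing Ext-side.  New names only.
-/

open Module Polynomial
open scoped Matrix Polynomial

namespace Summit.Ventures.HSemireg.Wedge.HankelOuter

open Summit.Ventures.HSemireg.Wedge Summit.Ventures.HSemireg.Wedge.Hankel

variable (K : Type*) [Field K] {N : ℕ}

/-! ## §600. One formula for all degrees -/

/-- `K[X]_{<0} = 0`. -/
theorem degreeLT_zero_eq_bot : Polynomial.degreeLT K 0 = ⊥ := by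
  ext p
  rw [Polynomial.mem_degreeLT, Nat.cast_zero, Nat.WithBot.lt_zero_iff, Polynomial.degree_eq_bot, Submodule.mem_bot]

/-- the empty piece: `m·K[X]_{<0} = 0`. -/
theorem map_mulRight_degreeLT_zero (m : K[X]) : (Polynomial.degreeLT K 0).map (LinearMap.mulRight K m) = ⊥ := by
  rw [degreeLT_zero_eq_bot, Submodule.map_bot]

section AllDegrees

variable {K}
variable {r : ℕ} {q : ℕ → K} {m g : K[X]}

variable (K)

/-- **THE COMPLETE INTERSECTION IN EVERY DEGREE: `Rec^N_k(q) = m·K[X]_{≤ k−r} + g·K[X]_{≤ k−(N+2−r)}` for every `k ≤ N + 1`** (`R^N(q) = r ≥ 1`, `2r ≤ N + 1`, `0 ≠ m ∈ Rec_r(q)`, `g` a second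
generator; the indices are truncated differences: `k < r`: both pieces `0` and `Rec_k = 0`; `r ≤ k ≤ N + 1 − r`: only `m` (N18's window); `k ≥ N + 2 − r`: N56). -/
theorem recSpace_eq_sup_all_degrees (hq : (hankel1 K N (N / 2) q).rank = r) (hr : 1 ≤ r) (h2 : r + r ≤ N + 1) (hm : m ∈ recSpace K N q r) (hm0 : m ≠ 0)
    (hg : g ∈ recSpace K N q (N + 2 - r)) (hgA : g ∉ (Polynomial.degreeLT K (N + 2 - r - r + 1)).map (LinearMap.mulRight K m)) {k : ℕ} (hk : k ≤ N + 1) :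
    recSpace K N q k = (Polynomial.degreeLT K (k + 1 - r)).map (LinearMap.mulRight K m) ⊔ (Polynomial.degreeLT K (k + 1 - (N + 2 - r))).map (LinearMap.mulRight K g) := by
  rcases Nat.lt_or_ge k r with hkr | hkr
  · -- below the middle rank
    rw [recSpace_eq_bot_of_lt K hq hkr, show k + 1 - r = 0 by omega, show k + 1 - (N + 2 - r) = 0 by omega, map_mulRight_degreeLT_zero, map_mulRight_degreeLT_zero, bot_sup_eq]
  · rcases Nat.lt_or_ge k (N + 2 - r) with hkw | hkw
    · -- inside the window
      obtain ⟨d, rfl⟩ := Nat.exists_eq_add_of_le hkr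
      rw [recSpace_eq_map_mulRight K hq (by omega) hm hm0, show r + d + 1 - r = d + 1 by omega, show r + d + 1 - (N + 2 - r) = 0 by omega, map_mulRight_degreeLT_zero, sup_bot_eq]
    · -- beyond the window
      obtain ⟨j, rfl⟩ := Nat.exists_eq_add_of_le hkw
      rw [recSpace_beyond_eq_sup_of_not_mem K hq h2 hm hm0 hg hgA (j := j) (by omega), show N + 2 - r + j + 1 - r = N + 2 - r - r + j + 1 by omega,
        show N + 2 - r + j + 1 - (N + 2 - r) = j + 1 by omega]

/-- **THE SUM IS DIRECT IN EVERY DEGREE `k ≤ N + 1`.** -/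
theorem map_mulRight_inf_map_mulRight_eq_bot_all_degrees (hq : (hankel1 K N (N / 2) q).rank = r) (h2 : r + r ≤ N + 1) (hm : m ∈ recSpace K N q r) (hm0 : m ≠ 0)
    (hg : g ∈ recSpace K N q (N + 2 - r)) (hgA : g ∉ (Polynomial.degreeLT K (N + 2 - r - r + 1)).map (LinearMap.mulRight K m)) {k : ℕ} (hk : k ≤ N + 1) :
    (Polynomial.degreeLT K (k + 1 - r)).map (LinearMap.mulRight K m) ⊓ (Polynomial.degreeLT K (k + 1 - (N + 2 - r))).map (LinearMap.mulRight K g) = ⊥ := by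
  rcases Nat.lt_or_ge k (N + 2 - r) with hkw | hkw
  · rw [show k + 1 - (N + 2 - r) = 0 by omega, map_mulRight_degreeLT_zero, inf_bot_eq]
  · obtain ⟨j, rfl⟩ := Nat.exists_eq_add_of_le hkw
    rw [show N + 2 - r + j + 1 - r = N + 2 - r - r + j + 1 by omega, show N + 2 - r + j + 1 - (N + 2 - r) = j + 1 by omega]
    exact map_mulRight_inf_map_mulRight_eq_bot_of_not_mem K hq h2 hm hm0 hg hgA (by omega)

/-- **THE DIMENSIONS IN ONE FORMULA: `dim Rec^N_k(q) = (k + 1 − r) + (k + 1 − (N + 2 − r))` (truncated differences) for every `k ≤ N + 1`** — N15's trapezoid law read on the left kernel,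
now term by term from the two generators. -/
theorem finrank_recSpace_all_degrees (hq : (hankel1 K N (N / 2) q).rank = r) (hr : 1 ≤ r) (h2 : r + r ≤ N + 1) (hm : m ∈ recSpace K N q r) (hm0 : m ≠ 0)
    (hg : g ∈ recSpace K N q (N + 2 - r)) (hgA : g ∉ (Polynomial.degreeLT K (N + 2 - r - r + 1)).map (LinearMap.mulRight K m)) {k : ℕ} (hk : k ≤ N + 1) :
    finrank K (recSpace K N q k) = (k + 1 - r) + (k + 1 - (N + 2 - r)) := by
  have hg0 : g ≠ 0 := by rintro rfl; exact hgA (Submodule.zero_mem _)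
  have hsum := Submodule.finrank_sup_add_finrank_inf_eq ((Polynomial.degreeLT K (k + 1 - r)).map (LinearMap.mulRight K m)) ((Polynomial.degreeLT K (k + 1 - (N + 2 - r))).map (LinearMap.mulRight K g))
  rw [← recSpace_eq_sup_all_degrees K hq hr h2 hm hm0 hg hgA hk, map_mulRight_inf_map_mulRight_eq_bot_all_degrees K hq h2 hm hm0 hg hgA hk, finrank_bot, Nat.add_zero,
    finrank_map_mulRight_degreeLT K hm0, finrank_map_mulRight_degreeLT K hg0] at hsum
  exact hsum

end AllDegrees

end Summit.Ventures.HSemireg.Wedge.HankelOuter
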